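import Literature.Computability.AlgebraicComplexity.DeterminantalComplexity
import Literature.Computability.AlgebraicComplexity.PencilFamily
import Literature.LinearAlgebra.Matrix.AdjugateKernelLine
import Summits.ValiantsHypothesis.ValiantsHypothesis.Theorems.UlrichPaddedOrbitCorankTwoUntwist

/-!
# Untwist certificates for `UlrichPadded.OrbitCorankTwo` (stmt-ValiantsHypothesis-15032)

A per-representation certificate format for the crux conclusion: if the linear part `L` of an affine
determinantal representation `A = A₀ + L` of `f` has a kernel vector `c` of linear forms, `e` is a
constant vector with `eᵀ c = 0`, and `v` is a second polynomial vector with `L v = -(eᵀ v) · A₀ c`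
not proportional to `c`, then the one-sided unipotent gauge `Q = 1 + c eᵀ` makes `A · Q` an affine
representation of `f` whose linear part `L + (A₀ c) eᵀ` kills both `c` and `v`, so its adjugate
vanishes identically (two non-proportional kernel vectors) — in particular every submaximal minor of
the linear part of `1 * A * Q` lies in any ideal.  This is the 'TightOrbitMove' of the route in
certificate form (numerically realised on the tight component of Rep₇(per₃), Cruxes/OrbitCorankTwo/ZprobeCycle1.md).
-/

noncomputable section

namespace Summit.ValiantsHypothesis.Theorems

open MvPolynomial Matrix
open Literature.Computability.AlgebraicComplexity

variable {σ : Type*} {m : Type*} [Fintype m] [DecidableEq m]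

/-- Linear part of the untwist: for affine `A`, linear `c` with `lin(A) c = 0` and a constant vector
`e`, the degree-one component of `A * (1 + c (C ∘ e)ᵀ)` is `lin A + (A₀ c) (C ∘ e)ᵀ`, entrywise
`homogeneousComponent 1 ((A * Q) a b) = homogeneousComponent 1 (A a b) + (∑ k, C (coeff 0 (A a k)) * c k) * C (e b)`.
[folklore] -/
theorem linPart_untwist (A : Matrix m m (MvPolynomial σ ℂ)) (hdeg : ∀ i j, (A i j).totalDegree ≤ 1)
    (c : m → MvPolynomial σ ℂ) (hc1 : ∀ i, (c i).IsHomogeneous 1)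
    (hc : (Matrix.of fun a b => homogeneousComponent 1 (A a b)).mulVec c = 0) (e : m → ℂ) :
    (Matrix.of fun a b => homogeneousComponent 1
        ((A * (1 + Matrix.of fun i j => c i * C (e j)) : Matrix m m (MvPolynomial σ ℂ)) a b)) =
      (Matrix.of fun a b => homogeneousComponent 1 (A a b)) +
        Matrix.of fun a b => (∑ k, C (coeff 0 (A a k)) * c k) * C (e b) := by
  ext a b
  -- the linear part of `A` kills `c` (row `a` of `hc`)
  have hlin : ∑ k, homogeneousComponent 1 (A a k) * c k = 0 := congr_fun hc a
  -- hence `(A c)_a = (A₀ c)_a` is a constant-coefficient combination of the linear forms `c k`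
  have hmv : (A *ᵥ c) a = ∑ k, C (coeff 0 (A a k)) * c k := by
    change ∑ k, A a k * c k = _
    calc ∑ k, A a k * c k
        = ∑ k, (C (coeff 0 (A a k)) * c k + homogeneousComponent 1 (A a k) * c k) :=
          Finset.sum_congr rfl fun k _ => by
            rw [← add_mul, ← homogeneousComponent_zero,
              ← eq_homogeneousComponent_zero_add_one (hdeg a k)]
      _ = ∑ k, C (coeff 0 (A a k)) * c k := by
          rw [Finset.sum_add_distrib, hlin, add_zero]
  -- the `(a, b)` entry of `A * (1 + c eᵀ)` is `A a b + (A₀ c)_a * e_b`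
  have hentry :
      (A * (1 + Matrix.of fun i j => c i * C (e j)) : Matrix m m (MvPolynomial σ ℂ)) a b =
        A a b + (∑ k, C (coeff 0 (A a k)) * c k) * C (e b) := by
    change (A * (1 + vecMulVec c fun j => C (e j))) a b = _
    rw [Matrix.mul_add, Matrix.mul_one, Matrix.mul_vecMulVec, Matrix.add_apply,
      Matrix.vecMulVec_apply, hmv]
  -- the correction term `(A₀ c)_a * e_b` is a linear form: `∑ (degree 0) * (degree 1) * (degree 0)`
  have hS : ((∑ k, C (coeff 0 (A a k)) * c k) * C (e b)).IsHomogeneous (0 + 1 + 0) :=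
    (IsHomogeneous.sum _ _ _ fun k _ => (isHomogeneous_C σ (coeff 0 (A a k))).mul (hc1 k)).mul
      (isHomogeneous_C σ (e b))
  rw [Matrix.of_apply, Matrix.add_apply, Matrix.of_apply, Matrix.of_apply, hentry, map_add,
    homogeneousComponent_eq_self hS]

/-- **Untwist certificate ⇒ the conclusion of `OrbitCorankTwo` for this representation.**  See the
module docstring; the gauge pair is `(P, Q) = (1, 1 + c (C ∘ e)ᵀ)` and the adjugate of the new linear
part is identically zero. [folklore] -/
theorem orbitCorankTwo_conclusion_of_untwistCertificate (f : MvPolynomial σ ℂ)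
    (A : Matrix m m (MvPolynomial σ ℂ)) (hA : IsAffineDetRepr f A)
    (c : m → MvPolynomial σ ℂ) (hc1 : ∀ i, (c i).IsHomogeneous 1)
    (hc : (Matrix.of fun a b => homogeneousComponent 1 (A a b)).mulVec c = 0)
    (e : m → ℂ) (he : ∑ i, C (e i) * c i = 0)
    (v : m → MvPolynomial σ ℂ)
    (hv : (Matrix.of fun a b => homogeneousComponent 1 (A a b)).mulVec v =
      -((∑ i, C (e i) * v i) • ((Matrix.of fun a b => C (coeff 0 (A a b))).mulVec c)))
    (hcv : ∃ k, v k • c ≠ c k • v) (I : Ideal (MvPolynomial σ ℂ)) :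
    ∃ P Q : Matrix m m (MvPolynomial σ ℂ), IsUnit P ∧ IsUnit Q ∧ IsAffineDetRepr f (P * A * Q) ∧
      ∀ i j, (Matrix.of fun a b => homogeneousComponent 1 ((P * A * Q) a b)).adjugate i j ∈ I := by
  refine ⟨1, 1 + Matrix.of fun i j => c i * C (e j), isUnit_one,
    untwist_isUnit c (fun j => C (e j)) he, ?_, ?_⟩
  · rw [Matrix.one_mul]
    exact untwist_isAffineDetRepr f A hA c hc1 hc e he
  · intro i j
    rw [Matrix.one_mul, linPart_untwist A hA.1 c hc1 hc e]
    -- the new linear part `L' = lin A + (A₀ c) (C ∘ e)ᵀ` kills both `c` and `v`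
    have key : ((Matrix.of fun a b => homogeneousComponent 1 (A a b)) +
        Matrix.of fun a b => (∑ k, C (coeff 0 (A a k)) * c k) * C (e b)).adjugate = 0 := by
      refine Literature.LinearAlgebra.Matrix.adjugate_eq_zero_of_mulVec_of_mulVec _ ?_ ?_ hcv
      · -- `L' c = L c + (A₀ c) (eᵀ c) = 0 + 0`
        rw [Matrix.add_mulVec, hc, zero_add]
        funext a
        change ∑ b, (∑ k, C (coeff 0 (A a k)) * c k) * C (e b) * c b = 0
        calc ∑ b, (∑ k, C (coeff 0 (A a k)) * c k) * C (e b) * c b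
            = (∑ k, C (coeff 0 (A a k)) * c k) * ∑ b, C (e b) * c b := by
              rw [Finset.mul_sum]
              exact Finset.sum_congr rfl fun b _ => mul_assoc _ _ _
          _ = 0 := by rw [he, mul_zero]
      · -- `L' v = L v + (A₀ c) (eᵀ v) = -(eᵀ v) (A₀ c) + (A₀ c) (eᵀ v) = 0`
        rw [Matrix.add_mulVec, hv]
        funext a
        change -((∑ i, C (e i) * v i) * ∑ k, C (coeff 0 (A a k)) * c k) +
            ∑ b, (∑ k, C (coeff 0 (A a k)) * c k) * C (e b) * v b = 0
        have hsum : ∑ b, (∑ k, C (coeff 0 (A a k)) * c k) * C (e b) * v b =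
            (∑ k, C (coeff 0 (A a k)) * c k) * ∑ b, C (e b) * v b := by
          rw [Finset.mul_sum]
          exact Finset.sum_congr rfl fun b _ => mul_assoc _ _ _
        rw [hsum, mul_comm, neg_add_cancel]
    rw [key, Matrix.zero_apply]
    exact I.zero_mem

/-- **Registered stub form** (crux `UlrichPadded.OrbitCorankTwo`, stmt-ValiantsHypothesis-15032, in the
crux's own types and with the crux's own conclusion): an untwist certificate `(c, e, v)` for an affine
determinantal representation `A` of `per_n` — `c` linear with `lin A · c = 0`, `e` constant with
`∑ C (e i) * c i = 0`, `v` polynomial with `lin A · v = -(∑ C (e i) * v i) • (A₀ c)` and `v`, `c` not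
proportional — yields the conclusion of the crux FOR THIS `A` with `(P, Q) = (1, 1 + c (C ∘ e)ᵀ)`: the
adjugate of the linear part of `P * A * Q` vanishes identically.  (Example: for the tight twisted
Grenet `T` of `UlrichPaddedNoTightInfinity_refuted`, `c = X₂₀e₂ - X₁₀e₃`, `e = e₁`, `v = X₁₀e₁ - X₀₀e₂`.) [folklore] -/
theorem orbitCorankTwo_of_untwistCertificate : ∀ {n k : ℕ} (A : Matrix (Fin k) (Fin k) (MvPolynomial (Fin n × Fin n) ℂ)), IsAffineDetRepr (perPoly (Fin n) ℂ) A → ∀ (c : Fin k → MvPolynomial (Fin n × Fin n) ℂ), (∀ i, (c i).IsHomogeneous 1) → (Matrix.of fun a b => MvPolynomial.homogeneousComponent 1 (A a b)).mulVec c = 0 → ∀ (e : Fin k → ℂ), ∑ i, MvPolynomial.C (e i) * c i = 0 → ∀ (v : Fin k → MvPolynomial (Fin n × Fin n) ℂ), (Matrix.of fun a b => MvPolynomial.homogeneousComponent 1 (A a b)).mulVec v = -((∑ i, MvPolynomial.C (e i) * v i) • ((Matrix.of fun a b => MvPolynomial.C (MvPolynomial.coeff 0 (A a b))).mulVec c))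 → (∃ i, v i • c ≠ c i • v) → ∃ P Q : Matrix (Fin k) (Fin k) (MvPolynomial (Fin n × Fin n) ℂ), IsUnit P ∧ IsUnit Q ∧ IsAffineDetRepr (perPoly (Fin n) ℂ) (P * A * Q) ∧ ∀ i j, (Matrix.of fun a b => MvPolynomial.homogeneousComponent 1 ((P * A * Q) a b)).adjugate i j ∈ Ideal.span {perPoly (Fin n) ℂ} := by
  intro n k A hA c hc1 hc e he v hv hcv
  exact orbitCorankTwo_conclusion_of_untwistCertificate (perPoly (Fin n) ℂ) A hA c hc1 hc e he v hv hcv _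

end Summit.ValiantsHypothesis.Theorems

end
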